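import Literature.AlgebraicGeometry.HodgeTheory.FermatLevelMapFinite
import Literature.AlgebraicGeometry.HodgeTheory.SupportedClassesQuasiFinitePullback
import HarnessLib

/-!
# Pull-back along the level map `π : Xⁿ_{km} ⟶ Xⁿₘ` of the Fermat hypersurfaces preserves supported and algebraic classes

Family `hodge`, layer `Literature/AlgebraicGeometry/HodgeTheory`. PROOF FILE (theorems only: no
definition, no named fact). The level map `fermatLevelMap n hk hm : Xⁿ_{km} ⟶ Xⁿₘ`, `[xᵢ] ↦ [xᵢᵏ]`
(`HodgeTheory/FermatLevelMap`; Shioda–Katsura 1979 §1) is a finite morphism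
(`isFinite_fermatLevelMap_left`, `HodgeTheory/FermatLevelMapFinite`) between the smooth projective
`n`-folds `Xⁿ_{km}`, `Xⁿₘ` (`isSmoothProjective_fermatHypersurface`, `n ≥ 1`), so by the quasi-finite
equidimensional pull-back theorem (`map_mem_supportedClasses_of_locallyQuasiFinite`,
`HodgeTheory/SupportedClassesQuasiFinitePullback`) **`π^*` maps `Nᶜ Hᵃ(Xⁿₘ(ℂ); ℂ)` into
`Nᶜ Hᵃ(Xⁿ_{km}(ℂ); ℂ)` and `algebraicClasses (Xⁿₘ) p` into `algebraicClasses (Xⁿ_{km}) p`**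
(`map_mem_supportedClasses_of_fermatLevelMap`, `map_mem_algebraicClasses_of_fermatLevelMap`). This is
the instance at `π` of Fulton's Cor. 19.2 (b) (pull-back of algebraic classes along a morphism of
smooth projective varieties, the tree's UNPROVED named fact `fulton1998_map_mem_algebraicClasses`),
proved unconditionally: it is the input "(F) at `π = fermatLevelMap`" of the functoriality of Aoki's
claim under raising the level (`Summit…CancelByAnyClaimLattice.stub_claimLevelPull_of_transfer`).

Not treated: the transfer `H*(Xⁿ_{km}(ℂ); ℂ)^K = π^* H*(Xⁿₘ(ℂ); ℂ)`, `K = (μₖ)ⁿ⁺²` (Bredon II.19.2,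
named fact `bredon1997_quotient_cohomology_invariants`), the other input of that functoriality.

## References

* [ShiodaKatsura1979] T. Shioda, T. Katsura, *On Fermat varieties*, Tôhoku Math. J. 31 (1979), §1.
* [GrothendieckTopology1969] A. Grothendieck, Topology 8 (1969), §1 (functoriality of the
  filtration by codimension of support).
* [Fulton1998] W. Fulton, *Intersection Theory*, 2nd ed. (1998), §19.2 Cor. 19.2 (b) (cite-only).
-/

noncomputable section

open CategoryTheory AlgebraicGeometry

namespace Literature.AlgebraicGeometry.HodgeTheory

section Fermat

open Literature.AlgebraicGeometry.Motives

variable {n m k : ℕ}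

/-- **Codimension does not drop on preimages along the level map**: for `w ∈ Xⁿ_{km}`,
`codim π(w) ≤ codim w` (`π` finite between smooth projective `n`-folds, `n ≥ 1`).
[cite: ShiodaKatsura1979, §1] -/
theorem coheight_base_fermatLevelMap_le (hn : 1 ≤ n) (hk : 0 < k) (hm : 0 < m)
    (w : ↥(fermatHypersurface n (k * m)).left) :
    Order.coheight ((fermatLevelMap n hk hm).left.base w) ≤ Order.coheight w :=
  haveI := isFinite_fermatLevelMap_left (n := n) hk hm
  coheight_base_le_of_locallyQuasiFinite (isSmoothProjective_fermatHypersurface hn (Nat.mul_pos hk hm))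
    (isSmoothProjective_fermatHypersurface hn hm) (fermatLevelMap n hk hm) w

/-- **`π^*` respects the support filtration**: `π^*(Nᶜ Hᵃ(Xⁿₘ(ℂ); ℂ)) ⊆ Nᶜ Hᵃ(Xⁿ_{km}(ℂ); ℂ)` for
the level map `π = fermatLevelMap n hk hm` (`n, k, m ≥ 1`): `π` is finite
(`isFinite_fermatLevelMap_left`), hence quasi-finite, between smooth projective `n`-folds
(`map_mem_supportedClasses_of_locallyQuasiFinite`). [cite: GrothendieckTopology1969, §1]
[cite: ShiodaKatsura1979, §1] -/
theorem map_mem_supportedClasses_of_fermatLevelMap (hn : 1 ≤ n) (hk : 0 < k) (hm : 0 < m)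
    {a c : ℕ} {x : complexBetti (fermatHypersurface n m) a}
    (hx : x ∈ supportedClasses (fermatHypersurface n m) a c) :
    complexBetti.map (fermatLevelMap n hk hm) a x ∈ supportedClasses (fermatHypersurface n (k * m)) a c :=
  haveI := isFinite_fermatLevelMap_left (n := n) hk hm
  map_mem_supportedClasses_of_locallyQuasiFinite
    (isSmoothProjective_fermatHypersurface hn (Nat.mul_pos hk hm))
    (isSmoothProjective_fermatHypersurface hn hm) (fermatLevelMap n hk hm) hx

/-- **`π^*` preserves algebraic classes**: `π^*(algebraicClasses Xⁿₘ p) ⊆ algebraicClasses Xⁿ_{km} p`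
for the level map `π = fermatLevelMap n hk hm`, `[xᵢ] ↦ [xᵢᵏ]` (`n, k, m ≥ 1`) — Fulton's
Cor. 19.2 (b) at `π`, unconditionally (finite morphisms between smooth projective varieties of the
same dimension pull supported classes back to supported classes). [cite: Fulton1998, §19.2 Cor. 19.2 (b)]
[cite: ShiodaKatsura1979, §1] -/
theorem map_mem_algebraicClasses_of_fermatLevelMap (hn : 1 ≤ n) (hk : 0 < k) (hm : 0 < m) {p : ℕ}
    {x : complexBetti (fermatHypersurface n m) (2 * p)}
    (hx : x ∈ algebraicClasses (fermatHypersurface n m) p) :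
    complexBetti.map (fermatLevelMap n hk hm) (2 * p) x ∈ algebraicClasses (fermatHypersurface n (k * m)) p :=
  map_mem_supportedClasses_of_fermatLevelMap hn hk hm hx

/-- Submodule form: `algebraicClasses Xⁿₘ p ≤ (π^*)⁻¹ (algebraicClasses Xⁿ_{km} p)`.
[cite: Fulton1998, §19.2 Cor. 19.2 (b)] -/
theorem algebraicClasses_le_comap_map_fermatLevelMap (hn : 1 ≤ n) (hk : 0 < k) (hm : 0 < m) (p : ℕ) :
    algebraicClasses (fermatHypersurface n m) p ≤
      (algebraicClasses (fermatHypersurface n (k * m)) p).comap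
        (complexBetti.map (fermatLevelMap n hk hm) (2 * p)).hom := by
  intro x hx
  rw [Submodule.mem_comap]
  exact map_mem_algebraicClasses_of_fermatLevelMap hn hk hm hx

end Fermat

end Literature.AlgebraicGeometry.HodgeTheory

end
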